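import Mathlib
import HarnessLib
import HarnessLib.Audit
import Summits.HodgeConjecture.Statement
import Literature.AlgebraicGeometry.ModuliOfCurves.StableCurvesModuliCover
import Literature.AlgebraicGeometry.HodgeTheory.GysinFormalism
import HarnessLib.Audit.Status.Attr

/-!
Route: SaitoKurokawaBridge

DORMANT since 2026-08-26T23:56:45Z (reconciler: no traction for 5 d (last activity statement-closed at 2026-08-21T22:40:11Z); parked, not closed — `ledger route dormant route-HodgeConjecture-SaitoKurokawaBridge --off` to reactivate) — unstaffed, not closed; items shared with open routes are served there. `ledger route dormant <id> --off` reactivates.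

Route SaitoKurokawaBridge — HodgeConjecture, NEGATIVE side (a designed two-sided TEST of HC at the
Saito–Kurokawa class); realises idea card HodgeConjecture/HodgeConjecture/saito-kurokawa-prym-bridge
(graded new-combination).

Thesis X (words). To refute HC it suffices to exhibit an EXTREME-TYPE BRIDGE FAILURE: two smooth
projective n-folds Y, X, a rational class κ ∈ H²ⁿ((Y×X)(ℂ);ℚ) of Hodge type (n,n), and classes a ∈
H^{n,0}(Y), b ∈ H^{0,n}(X) with κ ∪ pr₁*a ∪ pr₂*b ≠ 0 while EVERY algebraic class κ' ∈ Nⁿ H²ⁿ(Y×X)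
satisfies κ' ∪ pr₁*a ∪ pr₂*b = 0 (decl ExtremeBridgeFailure, typed on the tree's canonical carriers;
Assembly `ExtremeBridgeFailure → ¬HodgeConjecture` is pure logic, PROVED in the planner's
Sketch.lean: HC at Y ⊗ X makes κ algebraic). The intended and, by Canning–Larson–Payne, sharpest
available witness is n = 17, Y = Ỹ → M̄_{1,17}, X = X̃ → M̄_{2,14} smooth projective Galois covers
of the Deligne–Mumford stacks, a = the class of f₁₈ dτ∧dz₁∧…∧dz₁₆ (H^{17,0}(M̄_{1,17}) ≅ S₁₈(SL₂ℤ)),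
b = the conjugate of the class of χ₁₀(Ω)dΩ₁₁dΩ₁₂dΩ₂₂⊗v (χ₁₀ = SK(f₁₈) ∈ S₁₀(Sp₄ℤ)), κ = the Hodge
class spanning ∧²s₁₈ ⊂ H³⁴(M̄_{1,17}×M̄_{2,14}) whose existence is the announced theorem of
Gu–Lee–Prasanna (crux SaitoKurokawaHodgeClass) and for which 'there is no known natural candidate'
cycle (arXiv:2605.20453, Problem 6.5, p.15, read).

Two layers (cruxes first, glue later). Layer 1 = where a cycle CANNOT live: the card's no-go lemmas
— (A) classes supported over a proper closed subset of a factor pair to zero with H^{n,0}⊗H^{0,n}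
(SupportedBridgeClassesVanish, typed: kills every covering/Humbert/N-elliptic correspondence), (C)
classes stable under an automorphism acting by −1 on a pair to zero
(SignSymmetricBridgeClassesVanish, typed: kills x-coordinate/ℙ¹-lift constructions), (B) over any
base with Hom(E, J(C)) = 0 generically the s₁₈-component has no fibrewise (Leray-0) part, by big
monodromy Sp₄×SL₂ of the Prym family (LerayTypeFilterPrym, informal) — leaving exactly ONE natural
family, the decorated fibre powers Γ_{a,δ} of the Prym double cover C_η → C ×E_η over R₂ = {(C,η)};
and where it therefore MUST be decided: crux PrymBridgePeriodVanishing (the s₁₈-component c(Γ_{a,δ})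
of every decorated Prym fibre power vanishes). Layer 2 (not filed): the census 'every
17/18-dimensional correspondence built from tautological maps, coverings and Prym bridges factors
through (A)–(C) or Γ_{a,δ}', and the Ikeda analogue on M̄_{3,16}.

DESIGNED TWO-SIDEDNESS (read this before grading): the card PREDICTS that PrymBridgePeriodVanishing
is FALSE (c(Γ₁₅) ≠ 0 for Γ₁₅ ⊂ M̄_{2,14}×M̄_{1,19}, an Ichino-type positivity). A refuter's proof of
¬PrymBridgePeriodVanishing, composed with the tautological correspondence s₁₈(−1) → s₁₈ (support
TautologicalTwistCorrespondence), IS an algebraic 17-cycle answering CLP Problem 6.5, reproves the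
Gu–Lee–Prasanna Hodge isomorphism geometrically, and closes this route `refuted` — meaning 'HC
CONFIRMED at the Saito–Kurokawa class', the more valuable outcome; a proof of
PrymBridgePeriodVanishing (expected tool: S₂×S₄ ⊂ S₆ ≅ Sp₄(𝔽₂) monodromy and sign characters) kills
the only natural candidate and upgrades κ_SK to the sharpest counterexample candidate known (a Hodge
class on a variety smooth and proper over ℤ with no cycle from any known source), which is what the
Target records. Either verdict is publishable mathematics; the no-go package (A)(B)(C) is the first
deliverable for anyone attacking Problem 6.5 (both refuter audits of the card).

Thesis X (Lean, one line, = item ExtremeBridgeFailure; lean check rc 0 with imports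
Summits.HodgeConjecture.HodgeConjecture.Statement +
Literature.AlgebraicGeometry.HodgeTheory.{GysinFormalism,AlgebraicClasses,RationalHodgeClasses};
every constant exists: Motives.SchemeOver, Motives.IsSmoothProjective,
HodgeTheory.complexBetti(.map), IsRationalClass, IsOfHodgeType, algebraicClasses,
SingularHomology.cupProduct, SemiCartesianMonoidalCategory.fst/snd,
MonoidalCategoryStruct.tensorObj):
∃ n Y X (hY : IsSmoothProjective n Y) (hX : IsSmoothProjective n X) (κ : complexBetti (Y ⊗ X) (2n))
(a : complexBetti Y n) (b : complexBetti X n), IsRationalClass κ ∧ IsOfHodgeType (n+n) (Y ⊗ X) (2n)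
n n κ ∧ IsOfHodgeType n Y n n 0 a ∧ IsOfHodgeType n X n 0 n b ∧ κ ∪ fst*a ∪ snd*b ≠ 0 ∧ ∀ κ' ∈
algebraicClasses (Y ⊗ X) n, κ' ∪ fst*a ∪ snd*b = 0.
Specific cruxes 2–4 and the two supports are informal until the wanted definition
StableCurvesModuliCover (smooth projective Galois covers of M̄_{g,n} with their universal property;
Looijenga 1994 / Boggi–Pikaart 2000 / Abramovich–Corti–Vistoli 2003) lands; their canonical-carrier
signatures are written out in the informal texts so that set-signature is mechanical afterwards.

Rationale: WHY THIS LINE. HC has no negative-side technique at all for RATIONAL classes (integral: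
Atiyah–Hirzebruch/Kollár; rational: nothing), so a negative route can only be a TEST at the most
exposed class. Canning–Larson–Payne (arXiv:2605.20453 §6, p.15, read) single it out: the lift
coincidence s₁₈ = W₁₇H¹⁷(M_{1,17}) (Eichler–Shimura for f₁₈ = ΔE₆) versus W₁₇H¹⁷(M_{2,14}) (χ₁₀ =
SK(f₁₈), local system V_{7,7} on A₂; Petersen arXiv:1310.2508) gives, granted the announced
Gu–Lee–Prasanna Hodge isomorphism, a Hodge (and Tate) class ∧²s₁₈ ⊂ H³⁴(M̄_{1,17} × M̄_{2,14}) on a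
variety smooth and proper over ℤ with 'no known natural candidate' cycle, and CLP explicitly ask for
a cycle 'or a proof of nonexistence'. The card imports three areas with an explicit dictionary: (i)
theta lifts/special cycles (Kudla–Millson doi:10.1007/bf02699880, Funke–Millson arXiv:math/0408050):
SK is a theta lift for (SL̃₂, PGSp₄), theta lifts are realised by special cycles WITH COEFFICIENTS =
Humbert surfaces on A₂ — which Lemma (A) shows are useless for the CROSS term (they do not
dominate); (ii) classical Prym geometry of genus 2 (Mumford 1974; Lange, Abelian Varieties over the
Complex Numbers (2023) §5.3 — held scan keyed book:lange1992-complex-abelian-varieties, PDF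
pp.264–267 read: étale double covers of a genus-(g+1) curve have g-dimensional Pryms, so genus 2 ↦
elliptic E_η = C_η/⟨σι̃⟩): the one family relating every genus-2 curve to elliptic curves and
dominating M₂, with ψ_*π^* = 0 on H¹ (fibrewise degenerate ⇒ Abel–Jacobi type, as Lemma (B)
demands); (iii) Hodge theory of correspondences on the tree's canonical carriers
(GysinFormalism/corrAct_eq_zero_of_supported is Lemma (A) for cycles and (k,0);
Grothendieck1969_supportedClasses_le_hodgeConiveau). Catalogue: a geometric/motivic lift
(automorphic lift ⇒ demanded correspondence, Oda/Murty–Ramakrishnan/Ichino–Prasanna template) plus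
one certified computation (a bridge period); no probabilistic/physical reformulation. Negative
framing: an instance of HC cannot assemble to the summit, its contrapositive can — the deciding
theorem is closes : ExtremeBridgeFailure → ¬HodgeConjecture (pure logic, certified native), and
since 2026-08-16 the crux layer reaches the Target ExtremeBridgeFailure by the typed glue
SaitoKurokawaHodgeClass → NoAlgebraicSaitoKurokawaBridge → ExtremeBridgeFailure (pure logic,
candidate proof on file); the positive programme of the card is, verbatim, the REFUTATION programme
of crux NoAlgebraicSaitoKurokawaBridge. Novelty and barrier audits: see the route's own Novelty and
Barriers fields.
RANKED CRUXES. rank 2 SaitoKurokawaHodgeClass [TYPED since the definition StableCurvesModuliCover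
landed (signature set by refuter rattack-3302, rc 0): there exist smooth projective Galois covers M
of M̄_{1,17} and N of M̄_{2,14} (StableCurvesModuliCover ℂ 1 17 / ℂ 2 14), a rational class κ of
Hodge type (17,17) on M.Z ⊗ N.Z, an M.G-invariant a ∈ H¹⁷(M.Z) of type (17,0) and an N.G-invariant b
∈ H¹⁷(N.Z) of type (0,17) with κ ∪ fst*a ∪ snd*b ≠ 0 — ⟺ Hom_{ℚ-HS}(s₁₈, H¹⁷(M̄_{2,14})) ≠ 0, the
ANNOUNCED theorem GLP26; the unproved named fact the witness needs, hence first]. rank 3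
NoAlgebraicSaitoKurokawaBridge [TYPED, added 2026-08-16 on the operator's route-choice hold
`target-unreachable` (option (a)): for ALL such M, N and all invariant a of type (17,0), b of type
(0,17), EVERY algebraic class κ' ∈ algebraicClasses (M.Z ⊗ N.Z) 17 = N¹⁷H³⁴ has κ' ∪ fst*a ∪ snd*b =
0 — the universal half of the Target at n = 17, i.e. 'the Hodge-and-Tate class spanning ∧²s₁₈ ⊂
H³⁴(M̄_{1,17} × M̄_{2,14}) of CLP Problem 6.5 is not algebraic'; DECISIVE and two-sided: refuted by
ANY algebraic 17-cycle with non-zero s₁₈-component (= Problem 6.5 answered, route closes refuted, HC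
confirmed here), proved only by a counterexample to HC (why it might fail: HC and Tate predict it
false; source arXiv:2605.20453 p.15)]. GLUE (support SaitoKurokawaBridgeGlue, rank 9, pure logic,
candidate proof saitoKurokawaBridgeGlue_holds in the planner's Sketch.lean, rc 0):
SaitoKurokawaHodgeClass → NoAlgebraicSaitoKurokawaBridge → ExtremeBridgeFailure (instantiate the
Target at n := 17, Y := M.Z, X := N.Z; 3·1+17−3 = 3·2+14−3 = 17 and 34 = 2·17, 51, 68 are closed
numerals). The remaining cruxes are SPECIAL CASES of / tools for rank 3 and are deliberately NOT
glued to it (that glue would be the census 'every algebraic class comes from these families', not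
theorem-shaped): rank 3 (second, sub-case) PrymBridgePeriodVanishing [informal: the decorated Prym
fibre powers Γ_{a,δ} have zero s₁₈-component; route review REVIEW-R2 (3) argues it is TRUE trivially
by Lemma (C) — single Abel–Prym inversions r_i ↦ σr_i are symmetries of every Γ_{a,δ} — and (4)
names a second candidate family D = C ×_{ℙ¹} E_{ijk} over 3|3 partitions passing (A),(B); the tenure
planner should restate it over D], rank 4 LerayTypeFilterPrym [informal: big monodromy ⊇ Sp₄×SL₂ of
(H¹(C), H¹(E_η)) over R₂ ⇒ no fibrewise Hodge class ⇒ s₁₈-components of cycles over such bases are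
of Leray degree ≥ 1], rank 5 SupportedBridgeClassesVanish and rank 6
SignSymmetricBridgeClassesVanish [TYPED no-go lemmas (A) and (C) on the canonical carriers: classes
supported over a proper closed subset of a factor, resp. stable under an automorphism acting by −1
on a, pair to zero; Deligne-level known results (Hodge III 8.2.8; automorphisms act trivially on top
cohomology) typed for the open floor — re-badge support at the next retriage now that ranks 2–3 are
typed (REVIEW-R2 (2))].
KILL CRITERIA. ¬NoAlgebraicSaitoKurokawaBridge proved — one cover pair, one invariant (a, b), one
algebraic κ' with κ' ∪ fst*a ∪ snd*b ≠ 0 (from a decorated Prym fibre power Γ_{a,δ}, from the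
(ℤ/2)²-bridge D = C ×_{ℙ¹} E_{ijk}, or from anything else, composed with the tautological twist
correspondences where needed) ⇒ the route closes `refuted` = CLP Problem 6.5 answered, GLP26
reproved geometrically, HC confirmed at the Saito–Kurokawa class (the prize; a
Theorems/…Refutation.lean). ¬PrymBridgePeriodVanishing proved ⇒ the same, via support
TautologicalTwistCorrespondence. ¬SaitoKurokawaHodgeClass (GLP26 false) ⇒ no Hodge class, HC not
engaged: close the route moot and file the Tate-vs-Hodge divergence as a Literature remark.
¬LerayTypeFilterPrym ⇒ fibrewise correspondences re-enter the candidate list; restate the Prym crux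
over the larger family (no effect on rank 3). ExtremeBridgeFailure itself REFUTED in general (a
theorem 'Hodge-isomorphic extreme parts of two n-folds are always algebraically bridged') would
prove a famous open fragment of HC — welcome. The route closes `proved` only by a genuine
counterexample to HC: SaitoKurokawaHodgeClass ∧ NoAlgebraicSaitoKurokawaBridge ⊢
ExtremeBridgeFailure ⊢ ¬HodgeConjecture.
NOT DECOMPOSED YET. The census glue (no-go lemmas (A), (B), (C) + the Prym/D families ⟹
NoAlgebraicSaitoKurokawaBridge: 'every 17/18-dimensional correspondence built from tautological
maps, coverings and Prym/bi-elliptic bridges factors through (A)–(C) or Γ_{a,δ}, D') — not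
theorem-shaped until the candidate grammar is fixed, and never a claimed implication; the
restatement of PrymBridgePeriodVanishing over the family D of REVIEW-R2 (tenure planner, with the
forced twist t = |δ| − 2); the Ikeda/M̄_{3,16} sibling (second route if this one moves); the
4-dimensional enlargement {(C, η, E → E_η an N-isogeny)}.
CHEAPEST FALSIFIER. Exhibit ONE algebraic correspondence with non-zero s₁₈-component: the cheapest
candidates are the (ℤ/2)²-bridge D = C ×_{ℙ¹} E_{ijk} over the 3|3-partition cover of M₂ (REVIEW-R2
§4) and the decorated Prym fibre powers Γ_{a,δ}; a single certified non-vanishing period c ≠ 0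
(kit-computable in principle: Thomae–Rosenhain unwinding over R₂, or the Fourier–Jacobi expansion of
χ₁₀, Eichler–Zagier φ_{10,1}) refutes rank 3 and closes the route; on the other side the cheapest
partial confirmation is Lemma (C) killing every Γ_{a,δ} at once (REVIEW-R2 (3)), which costs nothing
and moves the test to D.
DEFINITION REQUESTS. StableCurvesModuliCover g n — LANDED
(Literature/AlgebraicGeometry/ModuliOfCurves/StableCurvesModuliCover.lean: smooth projective Z of
dimension 3g−3+n with a finite group action, an equivariant stable n-pointed genus-g curve, the
universal property `cover` + `transitive`, and the named fact nonempty_stableCurvesModuliCover from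
Looijenga 1994 / Boggi–Pikaart 2000); ranks 2–3 and the glue are typed over it. Still wanted for the
informal items (Prym cruxes and the two supports PrymCorrespondenceDegenerate,
TautologicalTwistCorrespondence): Jacobians/Pryms of curves with the Prym family R₂ and its cycle
classes on covers of M̄_{2,14} × M̄_{1,m}, a VHS/monodromy carrier, and the tautological/boundary
correspondences of M̄_{1,n}.

Novelty: Searched 2026-08-15 by this planner: `lit read arXiv:2605.20453` (READ p.15: s₁₈ :=
W₁₇H¹⁷(M_{1,17}); GLP26 announcement; Problem 6.5 verbatim with 'no known natural candidate' and 'or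
proving their nonexistence! would be most interesting'; 'every holomorphic 17-form on M̄_{g,n} is
pulled back from M̄_{1,17} or M̄_{2,14} [CLPW25b = arXiv:2509.08774]'); `lit frontier
HodgeConjecture --since 2022` (30 descendants; nearest thematically: arXiv:2401.13869 Prym
representations / twisted cohomology of the mapping class group — no cycles; arXiv:2603.20268 Weil
locus for abelian sixfolds — other sector); `lit bridges HodgeConjecture --cross any` (nothing on
lifts/moduli of curves); `lit galaxy search "Saito-Kurokawa" --star all` (pdf: 15 hits —
Fourier–Jacobi/analytic papers on Siegel forms, Kudla's theta notes, none on cycles for the cross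
term; panama saturated); `lit search --hybrid` local (book:lange1992-complex-abelian-varieties Ch.12
pp.264–267 READ for the elliptic Prym of a genus-2 double cover); openalex/arxiv remote tiers
rate-limited (429) this session — recorded. Plus the card's two refuter novelty audits
(2026-08-15T08:5x and 10:40Z: galaxy intelligent ×3, crossref ×20, hub grep of 109 cards; prior art
READ: arXiv:2605.20453 pp.21–22, arXiv:2411.12652 Rem.4.1, arXiv:1101.5489 §4.3–4.6, arXiv:1310.2508
Thm 2.1).
Nearest prior art actually found: (1) the problem statement itself, arXiv:2605.20453 Problem 6.5
(2026) — poses the cycle, offers no candidate and no constraint; (  [refs: 10.2307/2154385, 10.1007/bf02699880, 2605.20453, 2509.08774, 2401.13869, 2603.20268, 2411.12652, 1101.5489, 1310.2508, math/0408050, book:lange1992-complex-abelian-varieties, doi:10.2307/2154385, doi:10.1007/bf02699880]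

Barriers (technique_class: refutation, abel-jacobi, normal-functions, coniveau): technique_class: refutation, abel-jacobi, normal-functions, coniveau (also: theta-lifts,
moduli-of-curves, correspondences)
- Literature.Barriers.HodgeConjecture.Voisin2003_generalHypersurface_noIntegralClassInF
[normal-functions, abel-jacobi, jacobi-inversion]: APPLIES in spirit — Lemma (B) forces any SK cycle
over the Prym base to be of Abel–Jacobi/normal-function type. EVADED: no Jacobi INVERSION and no
Lefschetz-pencil induction is attempted; the normal function is GIVEN by an explicit algebraic
1-cycle (the double cover C_η inside C × E_η and its fibre powers), the only analytic step is the
(non-)vanishing of one period c(Γ₁₅), and the variations involved (R¹ of curves) have algebraic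
intermediate Jacobians (Picard varieties), unlike H^{2k-1} of a general hypersurface where Voisin's
obstruction lives.
- Literature.Barriers.HodgeConjecture.hodgeClassesAreAbsoluteFor_abelianVariety [refutation,
abelian-varieties, non-absolute-hodge-class]: does NOT apply — the witness variety is a product of
(covers of) moduli spaces of curves, not an abelian variety, and the route never argues through
non-absoluteness: κ_SK is absolute Hodge-compatible as far as anyone knows (its ℓ-adic companions
form the known Galois isomorphism), which is precisely why the test is sharp rather than pre-empted
by Deligne.
- Literature.Barriers.HodgeConjecture.Andre1996_hodgeClassesOnAbelianVarieties_motivated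
[refutation, counterexample-on-abelian-variety]: does NOT apply for the same reason (no abelian

Novelty grade: new-combination — ROUTE REVIEW (refuter, gen 1; novelty grade unchanged from the card's two audits — nearest prior art is the problem statement itself, CLP Problem 6.5, plus single-variety lift⇒cycle templates; delta = typed negative-side frame + no-go filters + Prym candidate; my own lit queries hit searchd rc 75 th (refuter refuter-rreview-route-AtomisticToContinu-9f46547e-0, 2026-08-15T14:06:18Z; prior: arXiv:2605.20453 (CLP 2026, Problem 6.5 p.15 — read), arXiv:1310.2508 (Petersen, SK classes on M_{2,n}), doi:10.1007/bf02699880 (Kudla–Millson special cycles), arXiv:math/0408050 (Funke–Millson), arXiv:2509.08774 (holomorphic forms on M̄_{g,n}))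

History (route lifecycle, newest last):
- 2026-08-16T03:54:38Z · AUTO-CRUX (edit): ExtremeBridgeFailure — hypotheses of the deciding theorem that nothing in the route derives are cruxes (planner-rrepair-HodgeConjecture-SaitoKurokawaB-2aa6a98f-0)
- 2026-08-26T23:56:45Z · DORMANT — reconciler: no traction for 5 d (last activity statement-closed at 2026-08-21T22:40:11Z); parked, not closed — `ledger route dormant route-HodgeConjecture-Saito (operator:999:3901103)

sub-problem: HodgeConjecture · status: dormant · opened planner-plancard-HodgeConjecture-HodgeConject-8ba8aa8a-0 2026-08-15T11:15:06Z · rev 12 · ledger route-HodgeConjecture-SaitoKurokawaBridge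
GENERATED by the gate from the ledger (D-0016/17). Provers cite these decls: `theorem foo : Summit.HodgeConjecture.HodgeConjecture.Theses.SaitoKurokawaBridge.<Decl> := …` in Summits/HodgeConjecture/HodgeConjecture/Theorems/<Name>.lean.
-/

namespace Summit.HodgeConjecture.HodgeConjecture.Theses.SaitoKurokawaBridge

open scoped BigOperators Topology Manifold Classical MeasureTheory ProbabilityTheory Matrix InnerProductSpace ComplexConjugate ContinuousMap
open Filter Set Function TopologicalSpace MeasureTheory

attribute [summit_statement] _root_.HodgeConjecture

/-- item stmt-HodgeConjecture-3275 · crux (kind.auto-crux: conjecture-grade) · rank 0 · open · by planner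
why it might fail: It asserts ¬HC in bridge form: false if Hodge-isomorphic extreme parts of two n-folds are always algebraically bridged (true for n=1; K3-type n=2 by Mukai/Buskin/Huybrechts). At the SK witness it fails as soon as one decorated Prym fibre power has c(Γ)≠0 — the card's own prediction.
sources: arXiv:2605.20453, arXiv:1310.2508, arXiv:2509.08774, Deligne2000
[target] EXTREME-TYPE BRIDGE FAILURE (thesis X): there are smooth projective n-folds Y, X over ℂ, a
RATIONAL class κ ∈ H²ⁿ((Y⊗X)(ℂ);ℂ) of Hodge type (n,n) (ambient dimension n+n), and classes a ∈
H^{n,0}(Y), b ∈ H^{0,n}(X) with κ ∪ fst*a ∪ snd*b ≠ 0 in H⁴ⁿ, while every ALGEBRAIC class κ' ∈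
algebraicClasses (Y⊗X) n = Nⁿ H²ⁿ pairs to zero: κ' ∪ fst*a ∪ snd*b = 0. By the Assembly this
refutes HC (HC at Y ⊗ X puts κ among the κ'). No junk witnesses in the known range: n = 0 (N⁰ =
everything) and n = 1 (Lefschetz (1,1) on Y×X) give none. INTENDED WITNESS (the route's thesis;
informal until StableCurvesModuliCover lands): n = 17, Y = Ỹ → M̄_{1,17} and X = X̃ → M̄_{2,14}
smooth projective Galois covers of the DM stacks, a = pull-back of the class of f₁₈ dτ∧dz₁∧…∧dz₁₆
(H^{17,0}(M̄_{1,17}) ≅ S₁₈(SL₂ℤ) = ℂ·ΔE₆), b = conjugate of the class of χ₁₀(Ω) dΩ₁₁∧dΩ₁₂∧dΩ₂₂ ⊗ v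
(χ₁₀ = Saito–Kurokawa lift of f₁₈), κ = the Hodge class spanning ∧²s₁₈ ⊂ H³⁴(M̄_{1,17} × M̄_{2,14})
of Canning–Larson–Payne Problem 6.5 (arXiv:2605.20453 p.15: 'no known natural candidate'), supplied
by crux SaitoKurokawaHodgeClass; the vanishing for all algebraic κ' is what cruxes 3–6 (no-go
filters + the Prym period) attack. -/
@[route_item "route-HodgeConjecture-SaitoKurokawaBridge", crux]
def ExtremeBridgeFailure : Prop :=
  ∃ (n : ℕ) (Y X : Literature.AlgebraicGeometry.Motives.SchemeOver ℂ) (_ : Literature.AlgebraicGeometry.Motives.IsSmoothProjective n Y) (_ : Literature.AlgebraicGeometry.Motives.IsSmoothProjective n X) (κ : Literature.AlgebraicGeometry.HodgeTheory.complexBetti (CategoryTheory.MonoidalCategoryStruct.tensorObj Y X) (2 * n)) (a : Literature.AlgebraicGeometry.HodgeTheory.complexBetti Y n) (b : Literature.AlgebraicGeometry.HodgeTheory.complexBetti X n), Literature.AlgebraicGeometry.HodgeTheory.IsRationalClass κ ∧ Literature.AlgebraicGeometry.HodgeTheory.IsOfHodgeType (n + n) (CategoryTheory.MonoidalCategoryStruct.tensorObj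 Y X) (2 * n) n n κ ∧ Literature.AlgebraicGeometry.HodgeTheory.IsOfHodgeType n Y n n 0 a ∧ Literature.AlgebraicGeometry.HodgeTheory.IsOfHodgeType n X n 0 n b ∧ Literature.AlgebraicTopology.SingularHomology.cupProduct (rfl : (2 * n + n) + n = 2 * n + n + n) (Literature.AlgebraicTopology.SingularHomology.cupProduct (rfl : 2 * n + n = 2 * n + n) κ (Literature.AlgebraicGeometry.HodgeTheory.complexBetti.map (CategoryTheory.SemiCartesianMonoidalCategory.fst Y X) n a)) (Literature.AlgebraicGeometry.HodgeTheory.complexBetti.map (CategoryTheory.SemiCartesianMonoidalCategory.snd Y X) n b) ≠ 0 ∧ ∀ κ' ∈ Literature.AlgebraicGeometry.HodgeTheory.algebraicClasses (CategoryTheory.MonoidalCategoryStruct.tensorObj Y X) n, Literature.AlgebraicTopology.SingularHomology.cupProduct (rfl : (2 * n + n) + n = 2 * n + n + n) (Literature.AlgebraicTopology.SingularHomology.cupProduct (rfl : 2 * n + n = 2 * n + n) κ' (Literature.AlgebraicGeometry.HodgeTheory.complexBetti.map (CategoryTheory.SemiCartesianMonoidalCategory.fst Y X) n a)) (Literature.AlgebraicGeometry.HodgeTheory.complexBetti.map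 (CategoryTheory.SemiCartesianMonoidalCategory.snd Y X) n b) = 0

-- item stmt-HodgeConjecture-3333 · crux · rank 3 · open · by planner — informal only, no Lean statement yet:
--   [crux] (rank 3 — DECISIVE, TWO-SIDED BY DESIGN; informal until defn StableCurvesModuliCover;
--   kit-computable in principle) PRYM BRIDGE PERIOD VANISHING. Notation: R₂ = pairs (C, η), C smooth of
--   genus 2, η ∈ J(C)[2]∖0 (⟺ 2|4 partition {w₅,w₆}⊔{w₁..w₄} of the Weierstrass points; R₂ → M₂ degree
--   15); π : C_η → C the étale double cover (genus 3), σ its deck involution, ι̃ a lift of the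
--   hyperelliptic involution, j := σι̃; E_η := C_η/⟨j⟩ ≅ {v² = ∏_{i≤4}(x − w_i)} elliptic = Prym of π
--   (Lange–Birkenhake Ch.12, pp.264–267); ψ : C_η → E_η degree 2; (C,η) ↦ E_η is DOMINANT onto M_{1,1}.
--   For a ≥ 14 and a de

-- item stmt-HodgeConjecture-3336 · crux · rank 4 · open · by planner — informal only, no Lean statement yet:
--   [crux] (rank 4 — NO-GO LEMMA (B), 'Leray type'; informal: needs the Prym family and a VHS/monodromy
--   layer) LERAY-TYPE FILTER FOR THE PRYM FAMILY. With the notation of crux PrymBridgePeriodVanishing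
--   (R₂ = pairs (C, η), C genus 2, η ∈ J(C)[2]∖0; E_η = C_η/⟨σι̃⟩ the elliptic Prym): (B1) MONODROMY:
--   over (every connected finite étale cover of) R₂ the polarised ℤ-VHS 𝕍 := R¹(C) ⊕ R¹(E_η) (weights 1,
--   ranks 4 and 2) has algebraic monodromy group / generic Mumford–Tate group containing Sp₄ × SL₂
--   (Zariski closure of monodromy = Sp(H¹C) × SL(H¹E_η)); equivalently for the generic (C,η), Hom(E_η,
--   J(C)) = 0

/-- item stmt-HodgeConjecture-3302 · aside · rank 2 · open · by planner
why it might fail: Announced, unpublished (GLP26, 2026): a period identity between χ₁₀ = SK(f₁₈) and f₁₈ of Ichino–Prasanna depth fixing the GL₂(ℚ)-class of the period point of a rank-2 weight-17 HS; if false, the SK Tate class over ℚ is not Hodge and HC is not engaged by Problem 6.5 at all.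
sources: arXiv:2605.20453, arXiv:1310.2508, Ichino, Invent. Math. 162 (2005), Looijenga, J. Alg. Geom. 3 (1994), Boggi–Pikaart, Compositio Math. 120 (2000)
[crux] (rank 2 — the unproved named fact the witness needs, hence FIRST; informal until defn
StableCurvesModuliCover lands) SAITO–KUROKAWA HODGE CLASS = Gu–Lee–Prasanna in canonical-carrier
form. Let Ỹ → M̄_{1,17} and X̃ → M̄_{2,14} be smooth projective Galois covers (finite groups G, G′)
of the Deligne–Mumford stacks of stable pointed curves (existence: Looijenga 1994 'Smooth
Deligne–Mumford compactifications by means of Prym level structures'; Boggi–Pikaart 2000;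
Abramovich–Corti–Vistoli 2003), so that H*(M̄_{g,n}, ℚ) = H*(cover, ℚ)^{group} as Hodge structures.
STATEMENT: there exist a RATIONAL class κ ∈ H³⁴((Ỹ ⊗ X̃)(ℂ); ℂ) (IsRationalClass κ) of Hodge type
(17,17) (IsOfHodgeType 34 (Ỹ ⊗ X̃) 34 17 17 κ), a G-invariant class a ∈ H¹⁷(Ỹ(ℂ);ℂ) of type (17,0)
(these are the pull-backs of H^{17,0}(M̄_{1,17}) ≅ S₁₈(SL₂ℤ) = ℂ·f₁₈, f₁₈ = ΔE₆, realised by f₁₈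
dτ∧dz₁∧…∧dz₁₆) and a G′-invariant class b ∈ H¹⁷(X̃(ℂ);ℂ) of type (0,17) (conjugates of the
pull-backs of H^{17,0}(M̄_{2,14}), spanned by χ₁₀(Ω) dΩ₁₁∧dΩ₁₂∧dΩ₂₂ ⊗ v, χ₁₀ ∈ S₁₀(Sp₄ℤ) the
Saito–Kurokawa lift of f₁₈, v in the (7,7)-isotypic part of (H^{1,0})^{⊗14}) such that κ ∪ fst*a ∪
snd*b ≠ 0 in H⁶⁸. Intended signature once the cover t -/
@[route_item "route-HodgeConjecture-SaitoKurokawaBridge"]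
def SaitoKurokawaHodgeClass : Prop :=
  ∃ (M : Literature.AlgebraicGeometry.ModuliOfCurves.StableCurvesModuliCover ℂ 1 17) (N : Literature.AlgebraicGeometry.ModuliOfCurves.StableCurvesModuliCover ℂ 2 14) (κ : Literature.AlgebraicGeometry.HodgeTheory.complexBetti (CategoryTheory.MonoidalCategoryStruct.tensorObj M.Z N.Z) 34) (a : Literature.AlgebraicGeometry.HodgeTheory.complexBetti M.Z 17) (b : Literature.AlgebraicGeometry.HodgeTheory.complexBetti N.Z 17), Literature.AlgebraicGeometry.HodgeTheory.IsRationalClass κ ∧ Literature.AlgebraicGeometry.HodgeTheory.IsOfHodgeType 34 (CategoryTheory.MonoidalCategoryStruct.tensorObj M.Z N.Z) 34 17 17 κ ∧ (∀ g : M.G, Literature.AlgebraicGeometry.HodgeTheory.complexBetti.map (M.act g).hom 17 a = a) ∧ Literature.AlgebraicGeometry.HodgeTheory.IsOfHodgeType 17 M.Z 17 17 0 a ∧ (∀ g : N.G, Literature.AlgebraicGeometry.HodgeTheory.complexBetti.map (N.act g).hom 17 b = b) ∧ Literature.AlgebraicGeometry.HodgeTheory.IsOfHodgeType 17 N.Z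 17 0 17 b ∧ Literature.AlgebraicTopology.SingularHomology.cupProduct (rfl : 51 + 17 = 68) (Literature.AlgebraicTopology.SingularHomology.cupProduct (rfl : 34 + 17 = 51) κ (Literature.AlgebraicGeometry.HodgeTheory.complexBetti.map (CategoryTheory.SemiCartesianMonoidalCategory.fst M.Z N.Z) 17 a)) (Literature.AlgebraicGeometry.HodgeTheory.complexBetti.map (CategoryTheory.SemiCartesianMonoidalCategory.snd M.Z N.Z) 17 b) ≠ 0

/-- item stmt-HodgeConjecture-14459 · aside · rank 3 · open · by planner
why it might fail: HC and Tate predict it is FALSE: the GLP26 Hodge class spanning ∧²s₁₈ should be algebraic (CLP Problem 6.5 asks for the cycle; theta-lift/Ichino pullback heuristics suggest cycles with coefficients); one algebraic κ' with non-zero pairing on one cover pair refutes it.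
sources: arXiv:2605.20453, arXiv:2509.08774, arXiv:1310.2508, doi:10.1007/bf02699880, Ichino, Invent. Math. 162 (2005), BoggiPikaart2000
[crux] (rank 3 — DECISIVE, two-sided; typed on the canonical carriers now that the definition
StableCurvesModuliCover has landed) NO ALGEBRAIC SAITO–KUROKAWA BRIDGE. For EVERY smooth projective
Galois cover M of M̄_{1,17} and N of M̄_{2,14} (StableCurvesModuliCover ℂ 1 17 / ℂ 2 14; M.Z, N.Z
smooth projective 17-folds, H*(Z)^G = H*(M̄_{g,n}) as Hodge structures), every M.G-invariant class a
∈ H¹⁷(M.Z(ℂ);ℂ) of Hodge type (17,0) (= pull-back of H^{17,0}(M̄_{1,17}) ≅ S₁₈(SL₂ℤ) = ℂ·ω(f₁₈), f₁₈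
= ΔE₆), every N.G-invariant class b ∈ H¹⁷(N.Z(ℂ);ℂ) of type (0,17) (= conjugate pull-back of
H^{17,0}(M̄_{2,14}) = ω(χ₁₀) ⊗ V_{(7,7)}, h^{17,0} = 429 by arXiv:2509.08774 p.13, χ₁₀ = SK(f₁₈);
W₁₇H¹⁷(M_{2,14}) is s₁₈-isotypic by the announced GLP26) and every ALGEBRAIC class κ' ∈
algebraicClasses (M.Z ⊗ N.Z) 17 = N¹⁷H³⁴ (ℂ-span of classes of codimension-17 cycles on the 34-fold
M.Z × N.Z): κ' ∪ fst*a ∪ snd*b = 0 in H⁶⁸. Equivalently (Poincaré duality + Künneth + invariants):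
no algebraic 17-cycle on M̄_{1,17} × M̄_{2,14}, nor on any level cover, induces a non-zero morphism
of Hodge structures s₁₈ = W₁₇H¹⁷(M_{1,17}) → H¹⁷(M̄_{2,14}); i.e. the Hodge-and-Tate class spanning
∧²s₁₈ ⊂ H³⁴(M̄_{1,17} × M̄_{ -/
@[route_item "route-HodgeConjecture-SaitoKurokawaBridge"]
def NoAlgebraicSaitoKurokawaBridge : Prop :=
  ∀ (M : Literature.AlgebraicGeometry.ModuliOfCurves.StableCurvesModuliCover ℂ 1 17) (N : Literature.AlgebraicGeometry.ModuliOfCurves.StableCurvesModuliCover ℂ 2 14) (a : Literature.AlgebraicGeometry.HodgeTheory.complexBetti M.Z 17) (b : Literature.AlgebraicGeometry.HodgeTheory.complexBetti N.Z 17), (∀ g : M.G, Literature.AlgebraicGeometry.HodgeTheory.complexBetti.map (M.act g).hom 17 a = a) → Literature.AlgebraicGeometry.HodgeTheory.IsOfHodgeType 17 M.Z 17 17 0 a → (∀ g : N.G, Literature.AlgebraicGeometry.HodgeTheory.complexBetti.map (N.act g).hom 17 b = b) → Literature.AlgebraicGeometry.HodgeTheory.IsOfHodgeType 17 N.Z 17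 0 17 b → ∀ κ' ∈ Literature.AlgebraicGeometry.HodgeTheory.algebraicClasses (CategoryTheory.MonoidalCategoryStruct.tensorObj M.Z N.Z) 17, Literature.AlgebraicTopology.SingularHomology.cupProduct (rfl : 2 * 17 + 17 + 17 = 2 * 17 + 17 + 17) (Literature.AlgebraicTopology.SingularHomology.cupProduct (rfl : 2 * 17 + 17 = 2 * 17 + 17) κ' (Literature.AlgebraicGeometry.HodgeTheory.complexBetti.map (CategoryTheory.SemiCartesianMonoidalCategory.fst M.Z N.Z) 17 a)) (Literature.AlgebraicGeometry.HodgeTheory.complexBetti.map (CategoryTheory.SemiCartesianMonoidalCategory.snd M.Z N.Z) 17 b) = 0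

/-- item stmt-HodgeConjecture-18127 · aside · rank 3 · open · by planner
why it might fail: HC & Tate predict a bridging cycle; by the proved assembly it must be a dominant prime correspondence, so ONE smooth 17-fold W generically finite over both covers (resolved Prym/bi-elliptic bridge D, Hecke-type graph) with ∫_W p*ω(f₁₈)∧q*ω̄(χ₁₀⊗v) ≠ 0 refutes it.
sources: arXiv:2605.20453, arXiv:1310.2508, arXiv:2509.08774, DeligneHodgeIII1974, Fulton1998, Ichino, Invent. Math. 162 (2005)
[crux] (rank 3 — DECISIVE, two-sided; the dominant-correspondence residue of
NoAlgebraicSaitoKurokawaBridge after the strategist's split of ExtremeBridgeFailure, 2026-08-17)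
SAITO–KUROKAWA PERIODS VANISH ON COMMON COVERS. For EVERY smooth projective Galois cover M of
M̄_{1,17} and N of M̄_{2,14} (StableCurvesModuliCover ℂ 1 17 / ℂ 2 14), every M.G-invariant a ∈
H¹⁷(M.Z(ℂ);ℂ) of Hodge type (17,0) (= pull-back of ω(f₁₈), f₁₈ = ΔE₆ ∈ S₁₈(SL₂ℤ)), every
N.G-invariant b ∈ H¹⁷(N.Z(ℂ);ℂ) of type (0,17) (= conjugate pull-back of ω(χ₁₀) ⊗ V_{(7,7)}, χ₁₀ =
SK(f₁₈)), and EVERY smooth projective 17-fold W with DOMINANT morphisms p : W → M.Z, q : W → N.Z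
(dense images; generically finite since all three have dimension 17): p^*a ∪ q^*b = 0 in H³⁴(W(ℂ);ℂ)
≅ ℂ, i.e. the period ∫_W p^*ω(f₁₈) ∧ q^*ω̄(χ₁₀⊗v) vanishes. WHY THIS PIECE: by the PROVED assembly
(Cruxes/ExtremeBridgeFailure/Split/ExtremeBridgeFailureSplit.lean: irreducible decomposition of
N¹⁷H³⁴(M.Z×N.Z) + no-go lemma (A) on both factors + Deligne III 8.2.8/Hironaka + projection formula)
SupportedBridgeClassesVanish ∧ this ⊢ NoAlgebraicSaitoKurokawaBridge and, with
SaitoKurokawaHodgeClass, ⊢ ExtremeBridgeFailure: every algebraic bridge has -/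
@[route_item "route-HodgeConjecture-SaitoKurokawaBridge", crux]
def SaitoKurokawaCoverPeriodsVanish : Prop :=
  ∀ (M : Literature.AlgebraicGeometry.ModuliOfCurves.StableCurvesModuliCover ℂ 1 17) (N : Literature.AlgebraicGeometry.ModuliOfCurves.StableCurvesModuliCover ℂ 2 14) (a : Literature.AlgebraicGeometry.HodgeTheory.complexBetti M.Z 17) (b : Literature.AlgebraicGeometry.HodgeTheory.complexBetti N.Z 17), (∀ g : M.G, Literature.AlgebraicGeometry.HodgeTheory.complexBetti.map (M.act g).hom 17 a = a) → Literature.AlgebraicGeometry.HodgeTheory.IsOfHodgeType 17 M.Z 17 17 0 a → (∀ g : N.G, Literature.AlgebraicGeometry.HodgeTheory.complexBetti.map (N.act g).hom 17 b = b) → Literature.AlgebraicGeometry.HodgeTheory.IsOfHodgeType 17 N.Z 17 0 17 b → ∀ (W : Literature.AlgebraicGeometry.Motives.SchemeOver ℂ) (_ : Literature.AlgebraicGeometry.Motives.IsSmoothProjective 17 W) (p : W ⟶ M.Z) (q : W ⟶ N.Z), closure (Set.range p.left.base) = Set.univ → closure (Set.range q.left.base) = Set.univ → Literature.AlgebraicTopology.SingularHomology.cupProduct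 (rfl : 17 + 17 = 17 + 17) (Literature.AlgebraicGeometry.HodgeTheory.complexBetti.map p 17 a) (Literature.AlgebraicGeometry.HodgeTheory.complexBetti.map q 17 b) = 0

/-- item stmt-HodgeConjecture-3276 · support · rank 5 · closed · proved by Summit.HodgeConjecture.HodgeConjecture.Theorems.saitoKurokawaBridge_supportedBridgeClassesVanish_proof @ 4e5b3342ae43 (prover) · by planner
why it might fail: As typed κ ranges over ALL complex classes killed by restriction and b over ∃-model Hodge types; the proof needs 'kernel of restriction = Gysin images of resolutions' (Deligne Hodge III 8.2.8: false integrally, absent from the tree) and the (0,n) pull-back vanishing; without X′ ≠ univ it is false.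
sources: VoisinHodgeII2003, DeligneHodgeII1971, GrothendieckTopology1969, arXiv:2605.20453
[crux] NO-GO LEMMA (A), canonical-carrier form (card: 'coniveau/dominance'): for smooth projective
n-folds Y, X and a proper Zariski-closed X′ ⊊ X, every class κ ∈ H²ⁿ((Y⊗X)(ℂ);ℂ) vanishing on (Y ×
(X∖X′))(ℂ) (i.e. supported over Y × X′) pairs to zero with fst*a ∪ snd*b for every a ∈ Hⁿ(Y) and
every b of Hodge type (n,0) or (0,n) on X. Consequence for the thesis: a correspondence that does
not dominate the M̄_{2,14} factor (all 'covering' loci {C → E of degree N}, Humbert/N-elliptic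
surfaces, Kudla–Millson special cycles) contributes nothing to the s₁₈ cross term; symmetric
statement for the first factor by swapping Y, X. Printed mechanism: ker(H²ⁿ(Y×X) → H²ⁿ(Y×(X∖X′))) ⊗
ℚ is spanned by Gysin images from resolutions of the components Y × X′_j (Deligne, Hodge III 8.2.8 /
Jannsen), the projection formula, and b|_{X̃′_j} = 0 because dim X̃′_j < n (tree:
IsOfHodgeType.map_eq_zero_of_lt_left for (k,0); the (0,k) case by conjugation, tree file
HodgeTheory/ComplexConjugation). For CYCLES and type (k,0) this is already the tree theorem
corrAct_eq_zero_of_supported (Voisin II Prop. 10.24); the item is its class-level, two-type upgrade.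
Typed now as one of the two typed cruxes the open floo -/
@[route_item "route-HodgeConjecture-SaitoKurokawaBridge", crux]
def SupportedBridgeClassesVanish : Prop :=
  ∀ (n : ℕ) (Y X : Literature.AlgebraicGeometry.Motives.SchemeOver ℂ), Literature.AlgebraicGeometry.Motives.IsSmoothProjective n Y → Literature.AlgebraicGeometry.Motives.IsSmoothProjective n X → ∀ (X' : Set X.left), IsClosed X' → X' ≠ Set.univ → ∀ (κ : Literature.AlgebraicGeometry.HodgeTheory.complexBetti (CategoryTheory.MonoidalCategoryStruct.tensorObj Y X) (2 * n)), Literature.AlgebraicGeometry.HodgeTheory.complexBetti.restrictCompl (CategoryTheory.MonoidalCategoryStruct.tensorObj Y X) ((CategoryTheory.SemiCartesianMonoidalCategory.snd Y X).left.base ⁻¹' X') (2 * n) κ = 0 → ∀ (a : Literature.AlgebraicGeometry.HodgeTheory.complexBetti Y n) (b : Literature.AlgebraicGeometry.HodgeTheory.complexBetti X n), (Literature.AlgebraicGeometry.HodgeTheory.IsOfHodgeType n X n n 0 b ∨ Literature.AlgebraicGeometry.HodgeTheory.IsOfHodgeType n X n 0 n b) → Literature.AlgebraicTopology.SingularHomology.cupProduct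 (rfl : (2 * n + n) + n = 2 * n + n + n) (Literature.AlgebraicTopology.SingularHomology.cupProduct (rfl : 2 * n + n = 2 * n + n) κ (Literature.AlgebraicGeometry.HodgeTheory.complexBetti.map (CategoryTheory.SemiCartesianMonoidalCategory.fst Y X) n a)) (Literature.AlgebraicGeometry.HodgeTheory.complexBetti.map (CategoryTheory.SemiCartesianMonoidalCategory.snd Y X) n b) = 0

-- `SupportedBridgeClassesVanish` holds: proved by `Summit.HodgeConjecture.HodgeConjecture.Theorems.saitoKurokawaBridge_supportedBridgeClassesVanish_proof` @ 4e5b3342ae43 (its module imports this route file, so no `_holds` link can be stated here).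

/-- item stmt-HodgeConjecture-3277 · support · rank 6 · closed · proved by Summit.HodgeConjecture.HodgeConjecture.Theorems.saitoKurokawaBridge_signSymmetricBridgeClassesVanish_proof @ 21f3857ae693 (prover) · by planner
why it might fail: Needs '(σ ▷ X)* = id on H⁴ⁿ((Y⊗X)(ℂ);ℂ)' (holomorphic automorphisms have degree +1; top cohomology of the connected compact (Y⊗X)(ℂ) is a line) — orientation/fundamental-class theory absent from the tree; false for anti-holomorphic σ or without IsIso, so the exact typing matters.
sources: VoisinHodgeI2002, Hatcher2002, arXiv:2605.20453
[crux] NO-GO LEMMA (C), canonical-carrier form (card: 'sign'): for smooth projective n-folds Y, X,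
an automorphism σ : Y ≅ Y over ℂ, a class κ ∈ H²ⁿ((Y⊗X)(ℂ);ℂ) with (σ ▷ X)*κ = κ and a ∈ Hⁿ(Y) with
σ*a = −a, one has κ ∪ fst*a ∪ snd*b = 0 for every b ∈ Hⁿ(X). Proof in print: pull the triple product
back by σ ▷ X (fst ∘ (σ▷X) = σ ∘ fst, snd ∘ (σ▷X) = snd, cupProduct_map) to get x = −(σ▷X)*x in H⁴ⁿ,
and (σ▷X)(ℂ) is a biholomorphism of the compact connected complex 2n-fold (Y⊗X)(ℂ), hence acts as
the identity on top cohomology. Consequence for the thesis: f₁₈ dτ∧dz₁∧…∧dz₁₆ is odd under [−1] on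
any one marked point of M̄_{1,17} relative to the origin, so every correspondence transporting
points of C to points of an elliptic curve through the common quotient ℙ¹ = C/ι (lifting
x-coordinates; deck group contains single sign flips) has zero s₁₈-component — the second family of
'obvious' candidates is dead. Typed now for the open floor; expected to be re-badged support later. -/
@[route_item "route-HodgeConjecture-SaitoKurokawaBridge"]
def SignSymmetricBridgeClassesVanish : Prop :=
  ∀ (n : ℕ) (Y X : Literature.AlgebraicGeometry.Motives.SchemeOver ℂ), Literature.AlgebraicGeometry.Motives.IsSmoothProjective n Y → Literature.AlgebraicGeometry.Motives.IsSmoothProjective n X → ∀ (σ : Y ≅ Y) (κ : Literature.AlgebraicGeometry.HodgeTheory.complexBetti (CategoryTheory.MonoidalCategoryStruct.tensorObj Y X) (2 * n)) (a : Literature.AlgebraicGeometry.HodgeTheory.complexBetti Y n) (b : Literature.AlgebraicGeometry.HodgeTheory.complexBetti X n), Literature.AlgebraicGeometry.HodgeTheory.complexBetti.map (CategoryTheory.MonoidalCategoryStruct.whiskerRight σ.hom X) (2 * n) κ = κ → Literature.AlgebraicGeometry.HodgeTheory.complexBetti.map σ.hom n a = -a → Literature.AlgebraicTopology.SingularHomology.cupProduct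 (rfl : (2 * n + n) + n = 2 * n + n + n) (Literature.AlgebraicTopology.SingularHomology.cupProduct (rfl : 2 * n + n = 2 * n + n) κ (Literature.AlgebraicGeometry.HodgeTheory.complexBetti.map (CategoryTheory.SemiCartesianMonoidalCategory.fst Y X) n a)) (Literature.AlgebraicGeometry.HodgeTheory.complexBetti.map (CategoryTheory.SemiCartesianMonoidalCategory.snd Y X) n b) = 0

-- `SignSymmetricBridgeClassesVanish` holds: proved by `Summit.HodgeConjecture.HodgeConjecture.Theorems.saitoKurokawaBridge_signSymmetricBridgeClassesVanish_proof` @ 21f3857ae693 (its module imports this route file, so no `_holds` link can be stated here).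

/-- item stmt-HodgeConjecture-14460 · support · rank 9 · closed · proved by Summit.HodgeConjecture.HodgeConjecture.Theorems.saitoKurokawaBridgeGlue_proof @ eeba7a06571e (prover) · by planner
sources: Deligne2000, arXiv:2605.20453
[support] (rank 9; PURE LOGIC, provable now — candidate proof `saitoKurokawaBridgeGlue_holds` in the
planner's Sketch.lean, lean check rc 0 / 0 sorries, 2026-08-16) GLUE Crux… → Target, filed on the
operator's route-choice hold `target-unreachable` (option (a)): SaitoKurokawaHodgeClass →
NoAlgebraicSaitoKurokawaBridge → ExtremeBridgeFailure. Proof: take (M, N, κ, a, b) with their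
rationality / Hodge-type / invariance / non-vanishing hypotheses from SaitoKurokawaHodgeClass;
instantiate the Target with n := 17, Y := M.Z, X := N.Z — smooth projective of dimension 3·1+17−3 =
3·2+14−3 = 17 by the structure fields M.isSmoothProjective, N.isSmoothProjective — and the same κ,
a, b (the degrees 34 = 2·17 = 17+17, 51 = 2·17+17, 68 are closed numerals, so every conjunct matches
definitionally and `exact ⟨17, M.Z, N.Z, M.isSmoothProjective, N.isSmoothProjective, κ, a, b, …⟩`
elaborates); the Target's last clause is NoAlgebraicSaitoKurokawaBridge M N a b applied to the
invariance and Hodge-type hypotheses. With the deciding theorem closes : ExtremeBridgeFailure →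
¬HodgeConjecture the chain cruxes → Target → ¬Statement is complete (theorem closes_via_cruxes in
Sketch.lean). A prover lands it as -/
@[route_item "route-HodgeConjecture-SaitoKurokawaBridge"]
def SaitoKurokawaBridgeGlue : Prop :=
  SaitoKurokawaHodgeClass → NoAlgebraicSaitoKurokawaBridge → ExtremeBridgeFailure

-- `SaitoKurokawaBridgeGlue` holds: proved by `Summit.HodgeConjecture.HodgeConjecture.Theorems.saitoKurokawaBridgeGlue_proof` @ eeba7a06571e (its module imports this route file, so no `_holds` link can be stated here).

/-- item stmt-HodgeConjecture-18239 · support · rank 9 · closed · proved by Summit.HodgeConjecture.HodgeConjecture.Theorems.extremeBridgeFailureSplitGlue_proof @ 9e7316958882 (prover) · by planner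
[support] (rank 9; PURE LOGIC over the tree's theorems, PROVED by the strategist planner 2026-08-17
— candidate proof `extremeBridgeFailureSplitGlue_proof` in
Cruxes/ExtremeBridgeFailure/Split/ExtremeBridgeFailureSplit.lean, lean check rc 0 / 0 sorries; a
prover lands it verbatim as Theorems/SaitoKurokawaBridgeExtremeBridgeFailureSplit.lean) GLUE of the
strategist's BC2-redirect decomposition of the restated deciding crux: SaitoKurokawaHodgeClass →
SupportedBridgeClassesVanish → SaitoKurokawaCoverPeriodsVanish → ExtremeBridgeFailure (strategist
BC2 redirect, 2026-08-17). PROVED by the planner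
(Cruxes/ExtremeBridgeFailure/Split/ExtremeBridgeFailureSplit.lean, lean check rc 0 / 0 sorries, ~130
lines; a prover lands it verbatim under Theorems/): (i) N¹⁷H³⁴(M.Z⊗N.Z) is the sum over IRREDUCIBLE
closed V of codimension exactly 17 of ker(H³⁴ → H³⁴(∁V))
(algebraicClasses_eq_iSup_coheight_genericPoint_eq) and the pairing κ ↦ κ ∪ fst*a ∪ snd*b is linear;
(ii) V not dominating N.Z ⇒ Lemma (A) = SupportedBridgeClassesVanish with b of type (0,17); V not
dominating M.Z ⇒ its first-factor version, derived by the braiding Y⊗X ≅ X⊗Y + graded commutativity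
(supportedBridgeClassesVanish_fst); (iii) V -/
@[route_item "route-HodgeConjecture-SaitoKurokawaBridge"]
def ExtremeBridgeFailureSplitGlue : Prop :=
  SaitoKurokawaHodgeClass → SupportedBridgeClassesVanish → SaitoKurokawaCoverPeriodsVanish → ExtremeBridgeFailure

-- `ExtremeBridgeFailureSplitGlue` holds: proved by `Summit.HodgeConjecture.HodgeConjecture.Theorems.extremeBridgeFailureSplitGlue_proof` @ 9e7316958882 (its module imports this route file, so no `_holds` link can be stated here).

-- item stmt-HodgeConjecture-3348 · support · rank 9 · open · by planner — informal only, no Lean statement yet: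
--   [support] (rank 9; classical, provable as soon as Jacobians/Pic⁰ of curves and H¹ of C × E are
--   available; informal) THE PRYM CORRESPONDENCE IS FIBREWISE DEGENERATE. For EVERY smooth genus-2 curve
--   C/ℂ and every η ∈ J(C)[2]∖0, with π : C_η → C the étale double cover, σ the deck involution, ι̃ a
--   lift of the hyperelliptic involution ι and j := σι̃ (so ⟨σ, ι̃⟩ ≅ (ℤ/2)² acts on C_η with C_η/σ = C,
--   C_η/ι̃ ≅ ℙ¹, C_η/⟨σ,ι̃⟩ ≅ ℙ¹): (i) E_η := C_η/⟨j⟩ is an elliptic curve, ≅ the Prym variety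
--   Prym(C_η/C) = ker(Nm_π)⁰ = im(1 − σ) up to isogeny (Kani–Rosen for the Klein group: J(C_η) ~ J(C) ×
--   J(C_η/ι̃) × J(

-- item stmt-HodgeConjecture-3390 · support · rank 9 · open · by planner — informal only, no Lean statement yet:
--   [support] (rank 9; known in principle from the structure of H*(M̄_{1,n}); informal until
--   StableCurvesModuliCover) TWISTED COPIES OF s₁₈ ARE TAUTOLOGICALLY EQUIVALENT TO THE UNTWISTED ONE.
--   For n ≥ 17 and t ≥ 0 with 17 + 2t ≤ n: (i) the s₁₈-isotypic part of H^{17+2t}(M̄_{1,n}, ℚ) (classes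
--   of Hodge types (17+t, t) + (t, 17+t) generating sub-Hodge-structures isomorphic to s₁₈(−t)) is
--   spanned by images of s₁₈ ⊂ H¹⁷(M̄_{1,17}, ℚ) under compositions of pull-backs along forgetful maps
--   M̄_{1,m} → M̄_{1,17}, Gysin push-forwards along boundary gluing maps M̄_{1,m} × ∏ M̄_{0,k_i} →
--   M̄_{1,n} and along sect

/-- item stmt-HodgeConjecture-3278 · assembly · rank 1 · closed · proved by Summit.HodgeConjecture.HodgeConjecture.Theorems.saitoKurokawaBridge_assembly_proof @ 34198bccdf3d (prover) · by planner
sources: Deligne2000, arXiv:2605.20453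
[assembly] Pure logic, PROVED in the planner's Sketch.lean (theorem assembly_holds): from a witness
(n, Y, X, hY, hX, κ, a, b, …) apply HodgeConjecture at Y ⊗ X (smooth projective of dimension n+n by
Motives.IsSmoothProjective.tensor_holds hY hX), whose second conjunct at p = n puts the rational
(n,n)-class κ in algebraicClasses (Y ⊗ X) n; the witness's last clause then gives κ ∪ fst*a ∪ snd*b
= 0, contradicting ≠ 0. Conversely HodgeConjecture → ¬ExtremeBridgeFailure by the same term. The
route is negative-side: it settles the summit only by exhibiting the witness; its designed failure
mode (refutation of crux PrymBridgePeriodVanishing) is the positive resolution of CLP Problem 6.5. -/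
@[route_item "route-HodgeConjecture-SaitoKurokawaBridge"]
def Assembly : Prop :=
  ExtremeBridgeFailure → ¬ _root_.HodgeConjecture

-- `Assembly` holds: proved by `Summit.HodgeConjecture.HodgeConjecture.Theorems.saitoKurokawaBridge_assembly_proof` @ 34198bccdf3d (its module imports this route file, so no `_holds` link can be stated here).

/-! D-0027 §2.1 — DECIDING THEOREM (planner-authored via `route open/edit --closes-file`; by planner-rbadge-HodgeConjecture-SaitoKurokawaBr-2aa6a98f-g2-0 2026-08-15T16:12:23Z):
its hypotheses are this route's items and its conclusion the sub-problem Statement (glue_lint), and it elaborates with this file. -/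

/-- DECIDING THEOREM (D-0027 §2.1), negative side: an extreme-type bridge failure refutes the Hodge
conjecture. From a witness `(n, Y, X, hY, hX, κ, a, b, …)` apply `HodgeConjecture` at `Y ⊗ X`
(smooth projective of dimension `n + n` by `IsSmoothProjective.tensor_holds hY hX`); its cycle
conjunct at `p = n` puts the rational `(n,n)`-class `κ` in `algebraicClasses (Y ⊗ X) n`, and the
witness's last clause then gives `κ ∪ fst*a ∪ snd*b = 0`, contradicting `≠ 0`. Pure logic over the
tree's definitions; the only hypothesis is the route's Target item `ExtremeBridgeFailure`. -/
@[closes "route-HodgeConjecture-SaitoKurokawaBridge"] theorem closes (hX : ExtremeBridgeFailure) : ¬ _root_.HodgeConjecture := by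
  intro hHC
  obtain ⟨n, Y, X, hY, hXs, κ, a, b, hrat, hκ, _ha, _hb, hne, hall⟩ := hX
  have hYX : Literature.AlgebraicGeometry.Motives.IsSmoothProjective (n + n)
      (CategoryTheory.MonoidalCategoryStruct.tensorObj Y X) :=
    Literature.AlgebraicGeometry.Motives.IsSmoothProjective.tensor_holds hY hXs
  exact hne (hall κ ((hHC hYX).2 n κ hrat hκ))

end Summit.HodgeConjecture.HodgeConjecture.Theses.SaitoKurokawaBridge
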